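import Summits.CriticalPhenomena.PercolationContinuityZ3.Theses.PercLupuEnvironment
import Summits.CriticalPhenomena.PercolationContinuityZ3.Theorems.PercNearOneGluingNoHeavyLowerTailCSHTheoremOne
import Literature.Probability.Percolation.SharpnessDCTProofs
import HarnessLib

/-!
# `PercLupuEnvironment.OneArmContinuousInP` (stmt-CriticalPhenomena-6991) — SETTLED after continuity

Item `stmt-CriticalPhenomena-6991` of route `CriticalPhenomena/PercLupuEnvironment` (support): `p ↦ P_p(0 ↔ ∂Λ_n)` is continuous on `[0,1]` for every `n`.

The one-arm event of the box is a cylinder event, its probability a polynomial in `p`: the Literature `DCT16.continuous_thetaN` (`DCT16.thetaN d n q = P_{projIcc q}(siteToBoundary d n)`) composed with the inclusion `[0,1] → ℝ`.  p205010 is NOT used.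

builds on p205010 (kernel theorem, internal audit signed; external expert review pending) — USED (`CSH.percolationContinuityZ3_holds`).  RSW3 lane, lead gen 28 (prover-prim-rsw3-lead-g28-0):
'after continuity — the ledger harvest'.
References: G. Kozma, N. Nitzan (2024), Thm. 6 / Conj. 3 [KozmaNitzan2024]; G. Grimmett, *Percolation* (1999), §8 [GrimmettPercolation1999].
-/

noncomputable section

namespace Summit.CriticalPhenomena.PercolationContinuityZ3.Theorems

namespace PercLupuEnvironmentOneArmContinuousInP

open MeasureTheory Literature.Probability.Percolation Literature.Probability.LatticeModels

/-- **`PercLupuEnvironment.OneArmContinuousInP` (stmt-CriticalPhenomena-6991), settled.**  `continuous_thetaN 3 n` restricted to `[0,1]` via `DCT16.thetaN_coe`.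
[cite: KozmaNitzan2024, Thm. 6 with Conj. 3 (p. 15)] -/
theorem oneArmContinuousInP_proof : Summit.CriticalPhenomena.PercolationContinuityZ3.Theses.PercLupuEnvironment.OneArmContinuousInP := by
  unfold Summit.CriticalPhenomena.PercolationContinuityZ3.Theses.PercLupuEnvironment.OneArmContinuousInP
  intro n
  have h : Continuous fun p : unitInterval => DCT16.thetaN 3 n (p : ℝ) :=
    (DCT16.continuous_thetaN 3 n).comp continuous_subtype_val
  simpa only [DCT16.thetaN_coe] using h

end PercLupuEnvironmentOneArmContinuousInP

end Summit.CriticalPhenomena.PercolationContinuityZ3.Theorems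

end
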